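import Literature.MathematicalPhysics.QuantumFieldTheory.Balaban1983to89.B4StripSums

/-!
# Road FP (binder row D1), H′2-IR TEMPLATE (owner l.21173 (α)): STRIP REGULARITY OF A QUOTIENT `D ∕ F` OF FAT-HOLOMORPHIC SYMBOLS FROM A REAL LOWER BOUND OF
# THE DENOMINATOR — the generic form of the «regroup into entire ∕ entire-and-positive, Cauchy-estimate the imaginary Lipschitz constant, shift the contour»
# route (B4 p. 586 ∕ GK 1980 Prop. A.2), with the half-width `κ` an explicit function of `(c, M_F, d)` ONLY — hence UNIFORM over any family of symbols
# sharing the three constants (the block side `n` of IR-4b ∕ IR-2 ∕ IR-3 enters nowhere)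

HONEST DEPENDENCY (page 1, mandatory): continuum YM on T⁴ ⇐ BetaPertH ∧ nine spine estimates (0/9 proved); BetaPertH ⇐ (D1) ∧ (D4) ∧
CAP+tail; G-an2-4 gates asym, D1 and NE2/3/4.  HONEST FRAMING (cell contract, verbatim): «discharging `BetaPertH` makes Bałaban's UV
stability UNCONDITIONAL — a real constructive-QFT result; it is NOT the continuum limit and NOT the Clay problem.»  [folklore] complex analysis over
`B4Strip.strip_lower_bound`, `B4StripCauchy.imLipschitz_of_fat` and `B4ContourShift.StripRegular`∕`latticeKernel_decay` BY NAME; no `def`, no `def … : Prop`,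
nothing cited, 0 sorry; asserts nothing about any object of the series and discharges NOTHING of H′2-IR by itself (its instances are `FP/CoarseCovarianceSymbol`
(scalar, IR-4b decay half) and — intended — the matrix∕determinant symbols of IR-2∕IR-3).  0∕4 binders of row D1; NOT D1, NOT BetaPertH, NOT continuum, NOT Clay.

THE TEMPLATE.  Data: two symbols `D F : ℂ^{d+1} → ℂ`, holomorphic (jointly) at every point of the fat region `Fat (d+1) r`, `r = rOf (d+1)`, with
`‖D‖ ≤ M_D`, `‖F‖ ≤ M_F` there, and the REAL LOWER BOUND `2c ≤ ‖F(s)‖` on the Brillouin zone.  Then (§1) `F` is `(M_F∕r)`-Lipschitz in the imaginary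
directions on every strip of half-width `≤ r` (Cauchy's estimate), so `‖F‖ ≥ c` on `Strip (d+1) κ_Q`, **`κ_Q := min(r, c∕((M_F∕r)(d+1) + 1)) > 0`** —
a function of `(c, M_F, d)` alone; (§2) if moreover the QUOTIENT `D∕F` is `2π`-periodic across the sides of that strip (the alias-reindexing property of
every unit-lattice multiplier; `D` and `F` separately need not be periodic — they are not, in the instances), then `D∕F` is `StripRegular` on
`Strip (d+1) κ` with bound `M_D∕c` for every `0 ≤ κ ≤ κ_Q`, and (§3) its lattice kernel decays like `(M_D∕c)·e^{−κ‖w‖_∞}`.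
A FAMILY `(D_n, F_n)` with `n`-free `(c, M_D, M_F)` therefore has ONE `κ` and ONE decay constant for all `n` — the uniformity of GK Prop. A.2 ∕
B4 Lemma 2.4 ∕ B9 Thm 3.2 in the form road FP's IR-2∕IR-3∕IR-4b consume.  For MATRIX symbols `M̂` the intended use is `D := Δ^ξ·adj(F)_{ij}`, `F := det`
of the regrouped entire matrix (positive-definite on the zone ⟹ `det ≥ c^{rank}`).
Unit `b2b-balaban-beta-d1-formalise-leaf-06` (gen 7), 2026-08-20; `LEAVES-FP.md` rows IR-4b ∕ IR-2 (template per owner l.21173 (α)).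
-/

namespace Summit.QuantumFields.BalabanUV.Beta.FP.StripQuotient

open Complex Finset
open Literature.MathematicalPhysics.QuantumFieldTheory.Balaban1983to89
open B4Strip B4StripCauchy B5Strip145Analytic B5Strip145Decay B4ContourShift
open B4StripSums (tr_mem_Strip)
open scoped Real

noncomputable section

variable {d : ℕ}

/-! ## §1 The lower bound of the denominator on an explicit strip -/

/-- [folklore] Slices of a fat-holomorphic symbol are holomorphic. -/
theorem differentiableAt_slice {F : (Fin d → ℂ) → ℂ} {r : ℝ} (hF : ∀ q ∈ Fat d r, DifferentiableAt ℂ F q) {q : Fin d → ℂ}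
    (hq : q ∈ Fat d r) (μ : Fin d) : DifferentiableAt ℂ (fun w => F (Function.update q μ w)) (q μ) := by
  have h := hF q hq
  rw [← Function.update_eq_self μ q] at h
  exact h.comp (q μ) (differentiableAt_update q μ (q μ))

/-- [folklore] **LOWER BOUND ON AN EXPLICIT STRIP**: `F` fat-holomorphic with `‖F‖ ≤ M_F` on `Fat d (rOf d)` and `2c ≤ ‖F(s)‖` on real momenta ⟹ with
`κ_Q = min(rOf d, c∕((M_F∕rOf d)·d + 1))`: `0 < κ_Q` and `c ≤ ‖F p‖` on `Strip d κ_Q`.  (`κ_Q` depends on `(c, M_F, d)` only.) -/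
theorem lower_on_strip {F : (Fin d → ℂ) → ℂ} {M_F c : ℝ} (hc : 0 < c) (hM : 0 ≤ M_F)
    (hFdiff : ∀ q ∈ Fat d (rOf d), DifferentiableAt ℂ F q) (hFb : ∀ q ∈ Fat d (rOf d), ‖F q‖ ≤ M_F)
    (hreal : ∀ s : Fin d → ℝ, (∀ μ, |s μ| ≤ Real.pi) → 2 * c ≤ ‖F (ofRealVec s)‖) :
    0 < min (rOf d) (c / (M_F / rOf d * d + 1)) ∧ ∀ p ∈ Strip d (min (rOf d) (c / (M_F / rOf d * d + 1))), c ≤ ‖F p‖ := by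
  set Λ : ℝ := M_F / rOf d with hΛdef
  have hΛ : 0 ≤ Λ := div_nonneg hM (rOf_pos d).le
  have hden : 0 < Λ * d + 1 := by positivity
  set κ := min (rOf d) (c / (Λ * d + 1)) with hκ
  have hκpos : 0 < κ := lt_min (rOf_pos d) (div_pos hc hden)
  refine ⟨hκpos, ?_⟩
  have hκr : κ ≤ rOf d := min_le_left _ _
  have hsmall : Λ * (d * κ) ≤ c := by
    have h1 : κ ≤ c / (Λ * d + 1) := min_le_right _ _
    have h2 : Λ * d * κ ≤ Λ * d * (c / (Λ * d + 1)) := mul_le_mul_of_nonneg_left h1 (by positivity)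
    have h3 : Λ * d * (c / (Λ * d + 1)) ≤ c := by
      rw [mul_div_assoc', div_le_iff₀ hden]
      nlinarith [mul_nonneg hΛ (Nat.cast_nonneg d), hc]
    nlinarith
  have hlip := imLipschitz_of_fat F (rOf_pos d) hκpos.le hκr (fun q hq μ => differentiableAt_slice hFdiff hq μ) hFb
  exact strip_lower_bound F c Λ κ hreal hlip hΛ hsmall

/-! ## §2 Strip regularity of the quotient -/

/-- [folklore] **STRIP REGULARITY OF `D∕F`** on `Strip (d+1) κ`, `0 ≤ κ ≤ rOf (d+1)`: `D`, `F` fat-holomorphic, `‖D‖ ≤ M_D` on the fat region, `c ≤ ‖F‖` on the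
strip, and the quotient `2π`-periodic across the sides (stated at the left-side points through the tree's translate `tr`) ⟹ `StripRegular (D∕F) κ (M_D∕c)`. -/
theorem stripRegular_quotient {D F : (Fin (d + 1) → ℂ) → ℂ} {M_D c κ : ℝ} (hκ0 : 0 ≤ κ) (hκr : κ ≤ rOf (d + 1)) (hc : 0 < c)
    (hDdiff : ∀ q ∈ Fat (d + 1) (rOf (d + 1)), DifferentiableAt ℂ D q) (hDb : ∀ q ∈ Fat (d + 1) (rOf (d + 1)), ‖D q‖ ≤ M_D)
    (hFdiff : ∀ q ∈ Fat (d + 1) (rOf (d + 1)), DifferentiableAt ℂ F q) (hF : ∀ p ∈ Strip (d + 1) κ, c ≤ ‖F p‖)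
    (hside : ∀ p ∈ Strip (d + 1) κ, ∀ i : Fin (d + 1), (p i).re = -Real.pi → D (tr p i) / F (tr p i) = D p / F p) :
    StripRegular (d := d) (fun p => D p / F p) κ (M_D / c) := by
  have hfat : Strip (d + 1) κ ⊆ Fat (d + 1) (rOf (d + 1)) := strip_subset_fat (rOf_pos _).le hκr
  have hne : ∀ p ∈ Strip (d + 1) κ, F p ≠ 0 := by
    intro p hp h
    have := hF p hp
    rw [h, norm_zero] at this
    linarith
  have hdiffAt : ∀ p ∈ Strip (d + 1) κ, DifferentiableAt ℂ (fun p => D p / F p) p := by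
    intro p hp
    have h := (hDdiff p (hfat hp)).mul ((hFdiff p (hfat hp)).inv (hne p hp))
    refine h.congr_of_eventuallyEq (Filter.Eventually.of_forall fun q => ?_)
    simp only [Pi.mul_apply, Pi.inv_apply, div_eq_mul_inv]
  refine ⟨?_, ?_, ?_, ?_⟩
  · exact fun p hp => (hdiffAt p hp).continuousAt.continuousWithinAt
  · intro i q hq z hz
    have hP : i.insertNth z (ofRealVec q) ∈ Strip (d + 1) κ :=
      insertNth_mem_Strip hκ0 i hq (openRect_subset_closedRect κ hz)
    exact ((hdiffAt _ hP).comp z (differentiableAt_insertNth i _ z)).differentiableWithinAt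
  · intro i q hq y hy
    obtain ⟨hP, hre⟩ := insertNth_left_mem hκ0 i hq hy
    rw [← tr_insertNth_left]
    exact (hside _ hP i hre).symm
  · intro p hp
    have hD0 : 0 ≤ M_D := (norm_nonneg _).trans (hDb p (hfat hp))
    rw [norm_div, div_le_div_iff₀ (lt_of_lt_of_le hc (hF p hp)) hc]
    calc ‖D p‖ * c ≤ M_D * c := mul_le_mul_of_nonneg_right (hDb p (hfat hp)) hc.le
      _ ≤ M_D * ‖F p‖ := mul_le_mul_of_nonneg_left (hF p hp) hD0

/-! ## §3 The package: one half-width and one decay constant from `(c, M_D, M_F, d)` -/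

/-- [folklore] **THE TEMPLATE, EXISTENCE FORM.**  From fat holomorphy of `D`, `F`, the fat bounds `M_D`, `M_F`, the real lower bound `2c ≤ ‖F‖` on the zone
and side periodicity of `D∕F` on the strips of half-width `≤ rOf (d+1)`: with the EXPLICIT `κ_Q = min(rOf (d+1), c∕((M_F∕rOf (d+1))(d+1) + 1)) > 0`,
`StripRegular (D∕F) κ_Q (M_D∕c)` and `‖K[D∕F](w)‖ ≤ (M_D∕c)·e^{−κ_Q‖w‖_∞}` for every `w ∈ ℤ^{d+1}`. -/
theorem stripRegular_quotient_of_fat {D F : (Fin (d + 1) → ℂ) → ℂ} {M_D M_F c : ℝ} (hc : 0 < c) (hM : 0 ≤ M_F)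
    (hDdiff : ∀ q ∈ Fat (d + 1) (rOf (d + 1)), DifferentiableAt ℂ D q) (hDb : ∀ q ∈ Fat (d + 1) (rOf (d + 1)), ‖D q‖ ≤ M_D)
    (hFdiff : ∀ q ∈ Fat (d + 1) (rOf (d + 1)), DifferentiableAt ℂ F q) (hFb : ∀ q ∈ Fat (d + 1) (rOf (d + 1)), ‖F q‖ ≤ M_F)
    (hreal : ∀ s : Fin (d + 1) → ℝ, (∀ μ, |s μ| ≤ Real.pi) → 2 * c ≤ ‖F (ofRealVec s)‖)
    (hside : ∀ κ, 0 ≤ κ → κ ≤ rOf (d + 1) → ∀ p ∈ Strip (d + 1) κ, ∀ i : Fin (d + 1), (p i).re = -Real.pi →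
      F p ≠ 0 → F (tr p i) ≠ 0 → D (tr p i) / F (tr p i) = D p / F p) :
    StripRegular (d := d) (fun p => D p / F p) (min (rOf (d + 1)) (c / (M_F / rOf (d + 1) * (d + 1 : ℕ) + 1))) (M_D / c) ∧
    ∀ w : Fin (d + 1) → ℤ, ‖latticeKernel (fun p => D p / F p) w‖
      ≤ M_D / c * Real.exp (-(min (rOf (d + 1)) (c / (M_F / rOf (d + 1) * (d + 1 : ℕ) + 1)) * supNorm w)) := by
  obtain ⟨hκ, hF⟩ := lower_on_strip (d := d + 1) hc hM hFdiff hFb hreal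
  set κ := min (rOf (d + 1)) (c / (M_F / rOf (d + 1) * (d + 1 : ℕ) + 1)) with hκdef
  have hκr : κ ≤ rOf (d + 1) := min_le_left _ _
  have hne : ∀ p ∈ Strip (d + 1) κ, F p ≠ 0 := by
    intro p hp h
    have := hF p hp
    rw [h, norm_zero] at this
    linarith
  have hside' : ∀ p ∈ Strip (d + 1) κ, ∀ i : Fin (d + 1), (p i).re = -Real.pi → D (tr p i) / F (tr p i) = D p / F p :=
    fun p hp i hre => hside κ hκ.le hκr p hp i hre (hne p hp) (hne _ (tr_mem_Strip hp i hre))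
  have hreg := stripRegular_quotient (d := d) hκ.le hκr hc hDdiff hDb hFdiff hF hside'
  exact ⟨hreg, fun w => latticeKernel_decay hreg hκ.le w⟩

end

end Summit.QuantumFields.BalabanUV.Beta.FP.StripQuotient
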